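import Summits.BirchSwinnertonDyer.Rank2.LevelFifteenTwoAdicCoefficients
import HarnessLib

/-!
# Manin symbols on `Γ₀(15)`, VII: the coefficients `c₆, c₇` of `L₂(15A8, α, T)` modulo `4` — `ū` to `T⁸`

Cell `bsd-rank2` (D-0036), seat `bsd-rank2-eng` GEN 9 (BC5 rung, Stage B4⁺). Part VI certified `u = L₂/2 ≡ 1 + T³ + T⁴
(mod 2, T⁶)` from the Riemann sums at level `n = 6`; the bits `k = 6, 7` need `n = 7` (`v₂(6!) = v₂(7!) = 4`, truncation bound
`2^{1+4−n} ≤ 1/4`). Here: the kernel table `riemann_tables_seven` (`A(6,7), B(6,7), A(7,7), B(7,7)`, 128 summands each), the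
generic bit step at exponent `10` (`RS(k,7) = s·α⁻¹⁰(αA + B)/4`), and
**`padicLCoeff_refFifteen_mod_four_top`: `‖c₆/2 − s‖ ≤ 1/2`, `‖c₇/2‖ ≤ 1/2`** — so `ū ≡ 1 + T³ + T⁴ + T⁶ (mod 2, T⁸)`, matching
(★) for `15A8` modulo `T¹⁰` (numerics: HOME/bsd-rank2-eng/code/l15/).

THEOREMS ONLY (no definition, no named fact, no `sorry`). PARTITION: none — r_an ≥ 2, summit axis S0; TWIN (D-0056): n/a.
B1 honesty: finite `2`-adic arithmetic; nothing reads an analytic rank; no S0 motion.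

References: B. Mazur, J. Tate, J. Teitelbaum, *Invent. Math.* 84 (1986) §I.10–§I.13 [MazurTateTeitelbaum1986Invent];
J. E. Cremona, *Algorithms for modular elliptic curves* (1997) §2.8 [CremonaAlgorithms1997].
-/

noncomputable section

open Filter Topology
open scoped MatrixGroups ModularForm

open CongruenceSubgroup Literature.NumberTheory.EllipticCurves Literature.NumberTheory.EllipticCurves.ModularForms

namespace Summit.BirchSwinnertonDyer.Rank2.LevelFifteen

/-- The table entries at `n = 7` for `k = 6, 7` (kernel evaluation, 128 summands each). [folklore] -/
theorem riemann_tables_seven :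
    riemannA 6 7 = -6626761448 ∧ riemannB 6 7 = -141330326640 ∧
    riemannA 7 7 = 26156423520 ∧ riemannB 7 7 = -2224723026352 := by
  decide +kernel

/-- `16 ∣ 37·A(k,7) + B(k,7) − 8·37¹⁰·b_k` for `(k, b_k) = (6,1), (7,0)`. [folklore] -/
theorem cert_mod_sixteen_top :
    (16 : ℤ) ∣ 37 * riemannA 6 7 + riemannB 6 7 - 8 * 37 ^ 10 * 1 ∧
    (16 : ℤ) ∣ 37 * riemannA 7 7 + riemannB 7 7 - 8 * 37 ^ 10 * 0 := by
  obtain ⟨a6, b6, a7, b7⟩ := riemann_tables_seven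
  rw [a6, b6, a7, b7]
  norm_num

/-- `‖2‖₂ = 1/2`. [folklore] -/
private theorem norm_two_top : ‖(2 : ℚ_[2])‖ = (2 : ℝ)⁻¹ := by
  have h := Padic.norm_p (p := 2); simpa using h

/-- **The generic step at exponent `e`.** If `‖c − R‖ ≤ 1/4`, `R = s·α⁻ᵉ(αA + B)/4`, `s = ±1`, `‖α‖ = 1`, `α² + α + 2 = 0` and
`16 ∣ 37A + B − 8·37ᵉ·b`, then `‖c/2 − s·b‖ ≤ 1/2`. [cite: MazurTateTeitelbaum1986Invent, §I.13] -/
theorem norm_half_sub_bit_le_pow {α c R : ℚ_[2]} {σ A B b : ℤ} {e : ℕ} (hαu : ‖α‖ = 1) (hroot : α ^ 2 + α + 2 = 0)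
    (hσ : σ = 1 ∨ σ = -1) (hR : R = (σ : ℚ_[2]) * α⁻¹ ^ e * ((α * A + B) / 4))
    (herr : ‖c - R‖ ≤ (2 : ℝ)⁻¹ ^ 2) (hcert : (16 : ℤ) ∣ 37 * A + B - 8 * 37 ^ e * b) :
    ‖c / 2 - σ * b‖ ≤ (2 : ℝ)⁻¹ := by
  have hα0 : α ≠ 0 := by rintro rfl; norm_num at hroot
  have hαi : ‖α⁻¹‖ = 1 := by rw [norm_inv, hαu, inv_one]
  -- the key quantity `Q = αA + B − 8α⁹b` has norm ≤ 2⁻⁴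
  obtain ⟨q, hq⟩ := hcert
  have hQ : ‖α * A + B - 8 * α ^ e * b‖ ≤ (2 : ℝ)⁻¹ ^ 4 := by
    have hsplit : α * (A : ℚ_[2]) + B - 8 * α ^ e * b =
        16 * (q : ℚ_[2]) + (α - 37) * A + -(8 * (b : ℚ_[2]) * (α ^ e - 37 ^ e)) := by
      have hq' : (37 : ℚ_[2]) * A + B - 8 * 37 ^ e * b = 16 * q := by exact_mod_cast hq
      linear_combination hq'
    rw [hsplit]
    have h1 : ‖(16 : ℚ_[2]) * q‖ ≤ (2 : ℝ)⁻¹ ^ 4 := by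
      rw [norm_mul, show (16 : ℚ_[2]) = 2 ^ 4 by norm_num, norm_pow, norm_two_top]
      calc ((2 : ℝ)⁻¹) ^ 4 * ‖(q : ℚ_[2])‖ ≤ ((2 : ℝ)⁻¹) ^ 4 * 1 := by
            gcongr; exact Padic.norm_int_le_one q
        _ = _ := mul_one _
    have h2 : ‖(α - 37) * (A : ℚ_[2])‖ ≤ (2 : ℝ)⁻¹ ^ 4 := by
      rw [norm_mul]
      calc ‖α - 37‖ * ‖(A : ℚ_[2])‖ ≤ (2 : ℝ)⁻¹ ^ 7 * 1 :=
            mul_le_mul (norm_sub_thirtySeven_le hαu hroot) (Padic.norm_int_le_one A) (norm_nonneg _) (by positivity)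
        _ ≤ (2 : ℝ)⁻¹ ^ 4 := by norm_num
    have h3 : ‖-((8 : ℚ_[2]) * (b : ℚ_[2]) * (α ^ e - 37 ^ e))‖ ≤ (2 : ℝ)⁻¹ ^ 4 := by
      rw [norm_neg, norm_mul, norm_mul]
      have h8 : ‖(8 : ℚ_[2])‖ ≤ 1 := by
        rw [show (8 : ℚ_[2]) = ((8 : ℤ) : ℚ_[2]) by norm_num]; exact Padic.norm_int_le_one _
      have hb : ‖(b : ℚ_[2])‖ ≤ 1 := Padic.norm_int_le_one b
      have h8b : ‖(8 : ℚ_[2])‖ * ‖(b : ℚ_[2])‖ ≤ 1 := by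
        calc ‖(8 : ℚ_[2])‖ * ‖(b : ℚ_[2])‖ ≤ 1 * 1 := mul_le_mul h8 hb (norm_nonneg _) zero_le_one
          _ = 1 := one_mul _
      calc ‖(8 : ℚ_[2])‖ * ‖(b : ℚ_[2])‖ * ‖α ^ e - 37 ^ e‖ ≤ 1 * (2 : ℝ)⁻¹ ^ 7 :=
            mul_le_mul h8b (norm_pow_sub_pow_thirtySeven_le hαu hroot e) (norm_nonneg _) zero_le_one
        _ ≤ (2 : ℝ)⁻¹ ^ 4 := by norm_num
    refine (IsUltrametricDist.norm_add_le_max _ _).trans (max_le ?_ h3)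
    exact (IsUltrametricDist.norm_add_le_max _ _).trans (max_le h1 h2)
  -- `R/2 − s b = s α⁻⁹ Q / 8`
  have hσu : ‖(σ : ℚ_[2])‖ = 1 := by
    rcases hσ with rfl | rfl <;> simp
  have hσ2 : (σ : ℚ_[2]) * σ = 1 := by
    rcases hσ with rfl | rfl <;> norm_num
  have hRb : R / 2 - σ * b = (σ : ℚ_[2]) * α⁻¹ ^ e * (α * A + B - 8 * α ^ e * b) / 8 := by
    rw [hR]
    have hαpow : α⁻¹ ^ e * α ^ e = 1 := by rw [← mul_pow, inv_mul_cancel₀ hα0, one_pow]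
    linear_combination ((σ : ℚ_[2]) * b) * hαpow
  have hRb' : ‖R / 2 - σ * b‖ ≤ (2 : ℝ)⁻¹ := by
    rw [hRb, norm_div, norm_mul, norm_mul, hσu, norm_pow, hαi, one_pow, one_mul, one_mul,
      show (8 : ℚ_[2]) = 2 ^ 3 by norm_num, norm_pow, norm_two_top]
    rw [div_le_iff₀ (by positivity)]
    calc ‖α * ↑A + ↑B - 8 * α ^ e * ↑b‖ ≤ (2 : ℝ)⁻¹ ^ 4 := hQ
      _ = 2⁻¹ * (2⁻¹) ^ 3 := by ring
  -- `c/2 − s b = (c − R)/2 + (R/2 − s b)`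
  have hsplit : c / 2 - σ * b = (c - R) / 2 + (R / 2 - σ * b) := by ring
  rw [hsplit]
  refine (IsUltrametricDist.norm_add_le_max _ _).trans (max_le ?_ hRb')
  rw [norm_div, norm_two_top, div_le_iff₀ (by positivity)]
  calc ‖c - R‖ ≤ (2 : ℝ)⁻¹ ^ 2 := herr
    _ ≤ 2⁻¹ * 2⁻¹ := by norm_num

/-- **The coefficients `c₆, c₇` of `L₂(15A8, α, T)` modulo `4`.** For every newform `f` of `[1,1,1,0,0]` (with its
globally minimal structure `hmin`), `α = unitRoot` at `2`, `c_k = padicLCoeff f α k` and the sign `s = ±1` of part IV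
(`[0]⁺_f = −s/8`): `‖c₆/2 − s‖₂ ≤ 1/2` and `‖c₇/2‖₂ ≤ 1/2` — with part VI, `ū ≡ 1 + T³ + T⁴ + T⁶ (mod 2, T⁸)`. [cite: MazurTateTeitelbaum1986Invent, §I.10–§I.13] -/
theorem padicLCoeff_refFifteen_mod_four_top (hmin : (⟨1, 1, 1, 0, 0⟩ : WeierstrassCurve ℚ).IsGloballyMinimal)
    ⦃N : ℕ⦄ [NeZero N] (f : CuspForm (Gamma0 N) 2) (hW : IsNewformOf (⟨1, 1, 1, 0, 0⟩ : WeierstrassCurve ℚ) f) :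
    ∃ σ : ℤ, (σ = 1 ∨ σ = -1) ∧ ratPlusSymbol f 0 = -(σ : ℚ) / 8 ∧
      ∀ kb ∈ [((6 : ℕ), (1 : ℤ)), (7, 0)],
        ‖padicLCoeff f (@unitRoot (⟨1, 1, 1, 0, 0⟩ : WeierstrassCurve ℚ) hmin 2 _ : ℚ_[2]) kb.1 / 2 -
            σ * kb.2‖ ≤ (2 : ℝ)⁻¹ := by
  haveI : (⟨1, 1, 1, 0, 0⟩ : WeierstrassCurve ℚ).IsElliptic := refFifteen_isElliptic
  haveI := hmin
  -- pin the level: `N = 15`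
  have hsq : Squarefree ((⟨1, 1, 1, 0, 0⟩ : WeierstrassCurve ℚ).conductorNorm ℤ) := by
    rw [refFifteen_conductorNorm, show (15 : ℕ) = 3 * 5 by norm_num, Nat.squarefree_mul (by norm_num)]
    exact ⟨Nat.prime_three.prime.squarefree, Nat.prime_five.prime.squarefree⟩
  have hN : N = 15 := (hW.level_eq_conductorNorm_of_squarefree hsq).trans refFifteen_conductorNorm
  subst hN
  set α : ℚ_[2] := (@unitRoot (⟨1, 1, 1, 0, 0⟩ : WeierstrassCurve ℚ) hmin 2 _ : ℚ_[2]) with hαdef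
  have hord := refFifteen_isOrdinaryAt_two hmin
  obtain ⟨hαeq, hαu, hα0⟩ := unitRoot_coe_spec (W := (⟨1, 1, 1, 0, 0⟩ : WeierstrassCurve ℚ)) hord
  have ha₂ : (⟨1, 1, 1, 0, 0⟩ : WeierstrassCurve ℚ).frobeniusTrace 2 = -1 :=
    SymbolParityAtTwo.refFifteen_frobeniusTrace_two hmin
  have hroot : α ^ 2 + α + 2 = 0 := by
    rw [ha₂] at hαeq; push_cast at hαeq; rw [hαdef]; linear_combination hαeq
  have hroot' : α ^ 2 - ((-1 : ℤ) : ℚ_[2]) * α + 2 = 0 := by push_cast; linear_combination hroot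
  -- the Riemann sums in closed form (part V)
  obtain ⟨σ, hσ, h0, hRS⟩ := padicLRiemannSum_refFifteen_eq f hW
  refine ⟨σ, hσ, h0, ?_⟩
  -- the truncation bound with `C = 2`, `n = 6`
  have hreal : ∀ n, (cuspCoeff f n).im = 0 := cuspCoeff_im_eq_zero_of_coeffField_eq_bot hW.coeffField_eq_bot
  have hcusp : cuspCoeff f 2 = ((-1 : ℤ) : ℂ) := by
    rw [cuspCoeff_eq_frobeniusTrace_of_isNewformOf_holds hW hord.1, ha₂]
  have hαi : ‖α⁻¹‖ ≤ 1 := by rw [norm_inv, hαu, inv_one]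
  have hC := norm_msdMeasure_two_le_two_auto hW.1 hreal (by norm_num : ¬ 2 ∣ 15) hcusp hαi hroot'
  have hdist := msdMeasure_distribution_of_isNewformOf (W := (⟨1, 1, 1, 0, 0⟩ : WeierstrassCurve ℚ)) hord hW
  have herr : ∀ k : ℕ, k = 6 ∨ k = 7 → ‖padicLCoeff f α k - padicLRiemannSum f α k 7‖ ≤ (2 : ℝ)⁻¹ ^ 2 := by
    intro k hk
    have h := norm_padicLCoeff_sub_padicLRiemannSum_le (p := 2) (f := f) (α := α) hdist zero_le_two hC k 7
    refine h.trans ?_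
    have h45 : ‖((45 : ℤ) : ℚ_[2])‖ = 1 := le_antisymm (Padic.norm_int_le_one _) (not_lt.mp fun h ↦ by
      have h2 : (2 : ℤ) ∣ 45 := by exact_mod_cast (Padic.norm_intCast_lt_one_iff (p := 2)).mp h
      omega)
    have h315 : ‖((315 : ℤ) : ℚ_[2])‖ = 1 := le_antisymm (Padic.norm_int_le_one _) (not_lt.mp fun h ↦ by
      have h2 : (2 : ℤ) ∣ 315 := by exact_mod_cast (Padic.norm_intCast_lt_one_iff (p := 2)).mp h
      omega)
    have hfac : (2 : ℝ)⁻¹ ^ 4 ≤ ‖((k.factorial : ℕ) : ℚ_[2])‖ := by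
      rcases hk with rfl | rfl
      · rw [show ((Nat.factorial 6 : ℕ) : ℚ_[2]) = 2 ^ 4 * ((45 : ℤ) : ℚ_[2]) by norm_num [Nat.factorial], norm_mul,
          norm_pow, norm_two_top, h45, mul_one]
      · rw [show ((Nat.factorial 7 : ℕ) : ℚ_[2]) = 2 ^ 4 * ((315 : ℤ) : ℚ_[2]) by norm_num [Nat.factorial], norm_mul,
          norm_pow, norm_two_top, h315, mul_one]
    have hpos : (0 : ℝ) < ‖((k.factorial : ℕ) : ℚ_[2])‖ := lt_of_lt_of_le (by positivity) hfac
    rw [show ((2 : ℕ) : ℝ) ^ (-(7 : ℕ) : ℤ) = (2 : ℝ)⁻¹ ^ 7 by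
      rw [zpow_neg, zpow_natCast, inv_pow]; norm_num]
    calc 2 / ‖((k.factorial : ℕ) : ℚ_[2])‖ * (2 : ℝ)⁻¹ ^ 7
        ≤ 2 / (2 : ℝ)⁻¹ ^ 4 * (2 : ℝ)⁻¹ ^ 7 := by gcongr
      _ = (2 : ℝ)⁻¹ ^ 2 := by norm_num
  -- the two top bits
  obtain ⟨c6, c7⟩ := cert_mod_sixteen_top
  intro kb hkb
  simp only [List.mem_cons, List.mem_nil_iff, or_false] at hkb
  rcases hkb with rfl | rfl
  · exact norm_half_sub_bit_le_pow hαu hroot hσ (hRS α hα0 6 7) (herr 6 (by norm_num)) (by simpa using c6)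
  · exact norm_half_sub_bit_le_pow hαu hroot hσ (hRS α hα0 7 7) (herr 7 (by norm_num)) (by simpa using c7)

end Summit.BirchSwinnertonDyer.Rank2.LevelFifteen

end
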